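import Summits.ValiantsHypothesis.ValiantsHypothesis.Theorems.NewtonUnitEquationsTwoProductsTowerRecordLiftRecord
import Summits.ValiantsHypothesis.ValiantsHypothesis.Theorems.NewtonUnitEquationsTwoProductsTowerRecordLevels

/-!
# R13♯ lift — REALIZABLE-PAIR dissociation (the free widening): the Lift needs `pt` injective only on realizable pairs

(L4) val-idea-crit-8 g2's non-blocking R13♯ remark (23:40:01Z) in val-idea-37 g4's sharper form (memo rev 6 §10.3, (C3)): the degree-`D` Lift
(✓ `…TowerRecordLiftRecord`) uses tower dissociation only on TUPLE exponents, whose `z`-degree is REALIZABLE — it lies in the `|S|`-fold sumset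
`sumset E |S|` of the level set `E` (✓ `…TowerRecordLevels :: sumset`).  Hence the box hypothesis `TowerDissociated x d m D` (`k ≤ D|S|`) may be
replaced by `TowerDissociatedE x d m E` (`k ∈ sumset E |S|`), a STRICTLY WIDER class (witness alphabet `{b, b+d, b+2d, b+7d, 2b+5d}`, `m = 2`, idea-37
§10.3): `towerDissociatedE_of_towerDissociated` (box ⇒ realizable), `realizable_tupleExpT`, `pt_injOn_realizable`, `coeff_deltaUpT_tupleExpE`,
★ `exists_liveTopT_of_isStrictTopE` / `exists_isRecordT_of_isStrictTopE`, `exists_reindexE`, ★ `card_cellFamily_le_recordsE`.  The class law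
`LevelFreeCarrierLawE` (any finite level set, realizable-dissociated ⇒ per-cell `≤ 2^{11m}(t+2)`) follows in `…TowerRecordRealizableCarrier`.
Helper on crux `stmt-ValiantsHypothesis-5906` (line `relation_ladder`); `--supports`, closes nothing.  HONEST LABEL (crit-8 #19/#20): a CLASS rung
(parallel towers along ONE direction on realizable-dissociated carriers), INERT AS A HATCH; F10 fibre lumping ((S,k) ↦ S•x + k•d non-injective on
realizable pairs), ≥ 2 shift directions NOT covered; `PlanarCellBound`, `ResidualLawV24`, the crux and every summit statement UNMOVED; VP ≠ VNP NOT proved.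
No instances, no notation, no named facts. [folklore]
-/

set_option linter.dupNamespace false

noncomputable section

open Classical

namespace Summit.ValiantsHypothesis.ValiantsHypothesis.Theorems.NewtonUnitEquations.TwoProducts.TowerRecord

open scoped BigOperators
open Pointwise
open Summit.ValiantsHypothesis.ValiantsHypothesis.Theorems.NewtonUnitEquations.TwoProducts.FormalLogLinearisation
open Summit.ValiantsHypothesis.ValiantsHypothesis.Theorems.NewtonUnitEquations.TwoProducts.PlanarCell
open Summit.ValiantsHypothesis.ValiantsHypothesis.Theorems.NewtonUnitEquations.TwoProducts.MomentRecord

variable {m n : ℕ}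

/-! ## Realizable pairs and realizable dissociation -/

/-- `0 ∈ 0·E`. [folklore] -/
theorem zero_mem_sumset_zero (E : Finset ℕ) : (0 : ℕ) ∈ sumset E 0 := by
  simp [sumset]

/-- `k ∈ r·E`, `j ∈ E` ⇒ `k + j ∈ (r+1)·E`. [folklore] -/
theorem add_mem_sumset_succ {E : Finset ℕ} {r k j : ℕ} (hk : k ∈ sumset E r) (hj : j ∈ E) : k + j ∈ sumset E (r + 1) := by
  rw [sumset]
  exact Finset.add_mem_add hk hj

/-- Elements of `r·E` are at most `D·r` when `E ⊆ [0, D]`. [folklore] -/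
theorem le_of_mem_sumset {E : Finset ℕ} {D : ℕ} (hED : ∀ j ∈ E, j ≤ D) : ∀ {r k : ℕ}, k ∈ sumset E r → k ≤ D * r := by
  intro r
  induction r with
  | zero => intro k hk; simp [sumset] at hk; omega
  | succ r ih =>
    intro k hk
    rw [sumset, Finset.mem_add] at hk
    obtain ⟨a, ha, j, hj, rfl⟩ := hk
    have := ih ha
    have := hED j hj
    rw [Nat.mul_succ]
    omega

/-- **REALIZABLE-PAIR TOWER DISSOCIATION** (R13♯, the free widening): shallow pairs `|S| ≤ m` with REALIZABLE `k ∈ sumset E |S|` (a sum of `|S|`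
levels of `E`) are separated by their planar point `S•x + k•d`.  Weaker than the box form `TowerDissociated x d m D` for `E ⊆ [0,D]`. [folklore] -/
def TowerDissociatedE (x : Fin n → Expo) (d : Fin 2 → ℤ) (m : ℕ) (E : Finset ℕ) : Prop :=
  ∀ (S S' : Fin n → ℕ) (k k' : ℕ), size S ≤ m → size S' ≤ m → k ∈ sumset E (size S) → k' ∈ sumset E (size S') →
    ptZ x d S k = ptZ x d S' k' → (S = S' ∧ k = k')

/-- Box dissociation implies realizable dissociation for levels `E ⊆ [0, D]`. [folklore] -/
theorem towerDissociatedE_of_towerDissociated {x : Fin n → Expo} {d : Fin 2 → ℤ} {D : ℕ} {E : Finset ℕ} (hED : ∀ j ∈ E, j ≤ D)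
    (h : TowerDissociated x d m D) : TowerDissociatedE x d m E :=
  fun S S' k k' hS hS' hk hk' hpt => h S S' k k' hS hS' (le_of_mem_sumset hED hk) (le_of_mem_sumset hED hk') hpt

namespace Lift
open MvPolynomial
open Summit.ValiantsHypothesis.ValiantsHypothesis.Theorems.NewtonUnitEquations.TwoProducts.MomentRecord.Lift

section Realizable

variable {u v : Fin m → MvPolynomial (Fin 2) ℂ} {x : Fin n → Expo} {d : Fin 2 → ℤ} {E : Finset ℕ}

/-- REALIZABLE DISSOCIATION in exponent form: `pt` is injective on exponents with `ydeg ≤ m` and `z`-degree in `sumset E ydeg`. [folklore] -/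
theorem pt_injOn_realizable (hdis : TowerDissociatedE x d m E)
    {Ex E' : Option (Fin n) →₀ ℕ} (hE : ydeg Ex ≤ m) (hk : Ex none ∈ sumset E (ydeg Ex)) (hE' : ydeg E' ≤ m) (hk' : E' none ∈ sumset E (ydeg E'))
    (h : pt x d Ex = pt x d E') : Ex = E' := by
  rw [pt_eq_ptZ, pt_eq_ptZ] at h
  obtain ⟨hS, hkk⟩ := hdis _ _ _ _ hE hE' hk hk' h
  ext w
  cases w with
  | none => exact hkk
  | some i => exact congr_fun hS i

/-- Tuple exponents are REALIZABLE: `ydeg ≤ m` and the `z`-degree is a sum of `ydeg` levels of `E`. [folklore] -/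
theorem realizable_tupleExpT (halph : TowerAlphabet u v x d E) (a : Fin m → Expo) :
    ydeg (∑ j, lamT u v x d E (a j)) ≤ m ∧ (∑ j, lamT u v x d E (a j)) none ∈ sumset E (ydeg (∑ j, lamT u v x d E (a j))) := by
  classical
  have key : ∀ s : Finset (Fin m), ydeg (∑ j ∈ s, lamT u v x d E (a j)) ≤ s.card ∧
      (∑ j ∈ s, lamT u v x d E (a j)) none ∈ sumset E (ydeg (∑ j ∈ s, lamT u v x d E (a j))) := by
    intro s
    induction s using Finset.induction_on with
    | empty => simp [ydeg, zero_mem_sumset_zero]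
    | insert j s hj ih =>
      rw [Finset.sum_insert hj, Finset.card_insert_of_notMem hj, add_comm (lamT u v x d E (a j)), ydeg_add, Finsupp.add_apply]
      obtain ⟨ih1, ih2⟩ := ih
      by_cases he : a j ∈ tailSupport u v
      · obtain ⟨_, h1, h2⟩ := (isLetterExpT_lamT halph he).pt_eq (x := x) (d := d)
        rw [h1]
        exact ⟨by omega, add_mem_sumset_succ ih2 h2⟩
      · rw [lamT_of_not_mem he]
        have hy0 : ydeg (0 : Option (Fin n) →₀ ℕ) = 0 := by simp [ydeg]
        rw [hy0, add_zero, Finsupp.coe_zero, Pi.zero_apply, add_zero]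
        exact ⟨by omega, ih2⟩
  have h := key Finset.univ
  simp only [Finset.card_univ, Fintype.card_fin] at h
  exact h

/-- **Realizable-dissociated comparison of fibres.** [folklore] -/
theorem filter_tupleExp_eqE (hu : ∀ j, coeff 0 (u j) = 0) (hv : ∀ j, coeff 0 (v j) = 0)
    (halph : TowerAlphabet u v x d E) (hdis : TowerDissociatedE x d m E)
    (A : Fin m → Finset Expo) (hA : ∀ j, A j ⊆ tailSupport u v) {a : Fin m → Expo}
    (ha : a ∈ Fintype.piFinset (fun j => insert 0 (A j))) :
    (Fintype.piFinset (fun j => insert 0 (A j))).filter (fun b => ∑ j, lamT u v x d E (b j) = ∑ j, lamT u v x d E (a j)) =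
      (Fintype.piFinset (fun j => insert 0 (A j))).filter (fun b => ∑ j, b j = ∑ j, a j) := by
  classical
  have hmem : ∀ b ∈ Fintype.piFinset (fun j => insert 0 (A j)), ∀ j, b j ∈ insert (0 : Expo) (tailSupport u v) := by
    intro b hb j
    have := Fintype.mem_piFinset.mp hb j
    rcases Finset.mem_insert.mp this with h | h
    · exact Finset.mem_insert.mpr (Or.inl h)
    · exact Finset.mem_insert_of_mem (hA j h)
  have hpt : ∀ b ∈ Fintype.piFinset (fun j => insert 0 (A j)), pt x d (∑ j, lamT u v x d E (b j)) = ιZ (∑ j, b j) := by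
    intro b hb
    rw [pt_sum, ιZ_sum]
    exact Finset.sum_congr rfl fun j _ => pt_lamT hu hv halph (hmem b hb j)
  ext b
  simp only [Finset.mem_filter, and_congr_right_iff]
  intro hb
  constructor
  · intro h
    have := hpt b hb
    rw [h, hpt a ha] at this
    exact ιZ_injective this.symm
  · intro h
    have h1 := hpt b hb
    rw [h, ← hpt a ha] at h1
    obtain ⟨s1, s2⟩ := realizable_tupleExpT halph b
    obtain ⟨t1, t2⟩ := realizable_tupleExpT halph a
    exact pt_injOn_realizable hdis s1 s2 t1 t2 h1

/-- **Up = down on tuple classes** under realizable dissociation. [folklore] -/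
theorem coeff_deltaUpT_tupleExpE (hu : ∀ j, coeff 0 (u j) = 0) (hv : ∀ j, coeff 0 (v j) = 0)
    (halph : TowerAlphabet u v x d E) (hdis : TowerDissociatedE x d m E)
    {a : Fin m → Expo} (ha : a ∈ Fintype.piFinset (fun _ : Fin m => insert (0 : Expo) (tailSupport u v))) :
    coeff (∑ j, lamT u v x d E (a j)) (DeltaUpT (u := u) (v := v) (x := x) (d := d) (E := E)) = coeff (∑ j, a j) (tailDiff u v) := by
  classical
  have h0 : (0 : Expo) ∉ tailSupport u v := zero_not_mem_tailSupport hu hv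
  have hlam0 : lamT u v x d E 0 = 0 := lamT_of_not_mem h0
  have huA : ∀ j, (u j).support ⊆ tailSupport u v := fun j e he =>
    Finset.mem_union_left _ (Finset.mem_biUnion.mpr ⟨j, Finset.mem_univ _, he⟩)
  have hvA : ∀ j, (v j).support ⊆ tailSupport u v := fun j e he =>
    Finset.mem_union_right _ (Finset.mem_biUnion.mpr ⟨j, Finset.mem_univ _, he⟩)
  have hfil := filter_tupleExp_eqE hu hv halph hdis (fun _ => tailSupport u v) (fun _ => le_rfl) ha
  rw [DeltaUpT, coeff_sub, tailDiff, coeff_sub]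
  unfold ellUT ellVT
  rw [coeff_prod_one_add_liftW _ hlam0 u _ (fun _ => h0) huA, coeff_prod_one_add_liftW _ hlam0 v _ (fun _ => h0) hvA, hfil,
    ← coeff_prod_one_add_eq_fibreSum u _ (fun _ => h0) huA, ← coeff_prod_one_add_eq_fibreSum v _ (fun _ => h0) hvA]

/-- **THE TOWER RECORD OF A VISIBLE POINT under realizable dissociation.** [folklore] -/
theorem exists_liveTopT_of_isStrictTopE (hu : ∀ j, coeff 0 (u j) = 0) (hv : ∀ j, coeff 0 (v j) = 0)
    (halph : TowerAlphabet u v x d E) {D : ℕ} (hED : ∀ j ∈ E, j ≤ D) (hdis : TowerDissociatedE x d m E)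
    {ξ : Fin 2 → ℝ} (hval : ValidWeight u v ξ) {l : Expo} (htop : IsStrictTop ξ (↑(tailDiff u v).support) l) :
    ∃ Ex : Option (Fin n) →₀ ℕ, ydeg Ex ≤ m ∧ Ex none ∈ sumset E (ydeg Ex) ∧ pt x d Ex = ιZ l ∧
      layerT (gammaOf u v x d E u) (gammaOf u v x d E v) (Ex none) (fun i => Ex (some i)) ≠ 0 ∧
      ∀ E' : Option (Fin n) →₀ ℕ, E' ≠ Ex →
        layerT (gammaOf u v x d E u) (gammaOf u v x d E v) (E' none) (fun i => E' (some i)) ≠ 0 →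
          wtZ ξ (pt x d E') < wt ξ l := by
  classical
  set L := tailSupport u v with hL
  set κ := κw ξ x d with hκ
  set w₀ := wt ξ l with hw₀
  set γu := gammaOf u v x d E u
  set γv := gammaOf u v x d E v
  have h0 : (0 : Expo) ∉ L := zero_not_mem_tailSupport hu hv
  have huA : ∀ j, (u j).support ⊆ L := fun j e he => Finset.mem_union_left _ (Finset.mem_biUnion.mpr ⟨j, Finset.mem_univ _, he⟩)
  have hvA : ∀ j, (v j).support ⊆ L := fun j e he => Finset.mem_union_right _ (Finset.mem_biUnion.mpr ⟨j, Finset.mem_univ _, he⟩)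
  have hl : coeff l (tailDiff u v) ≠ 0 := mem_support_iff.mp (Finset.mem_coe.mp htop.1)
  obtain ⟨a₀, ha₀, hsum⟩ : ∃ a ∈ Fintype.piFinset (fun _ : Fin m => insert (0 : Expo) L), ∑ j, a j = l := by
    by_contra hne
    push Not at hne
    apply hl
    rw [tailDiff, coeff_sub, coeff_prod_one_add_eq_fibreSum u _ (fun _ => h0) huA,
      coeff_prod_one_add_eq_fibreSum v _ (fun _ => h0) hvA]
    have hempty : (Fintype.piFinset (fun _ : Fin m => insert (0 : Expo) L)).filter (fun a => ∑ j, a j = l) = ∅ :=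
      Finset.filter_eq_empty_iff.mpr fun a ha h => hne a ha h
    rw [hempty, Finset.sum_empty, Finset.sum_empty, sub_self]
  set Ex := ∑ j, lamT u v x d E (a₀ j) with hEx
  obtain ⟨hEm, hEk⟩ := realizable_tupleExpT halph a₀ (u := u) (v := v) (x := x) (d := d)
  have hptE : pt x d Ex = ιZ l := by
    rw [hEx, pt_sum, ← hsum, ιZ_sum]
    refine Finset.sum_congr rfl fun j _ => pt_lamT hu hv halph ?_
    exact Fintype.mem_piFinset.mp ha₀ j
  have hlwE : lw κ Ex = w₀ := by rw [hκ, lw_κw, hptE, wtZ_ιZ]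
  set G := coeff l (tailDiff u v) with hG
  have hcoeffE : coeff Ex (DeltaUpT (u := u) (v := v) (x := x) (d := d) (E := E)) = G := by
    rw [hEx, coeff_deltaUpT_tupleExpE hu hv halph hdis ha₀, hsum]
  have htopΔ : TopEq κ w₀ (DeltaUpT (u := u) (v := v) (x := x) (d := d) (E := E)) (monomial Ex G) := by
    intro E' hE'
    rw [coeff_monomial]
    by_cases hc : coeff E' (DeltaUpT (u := u) (v := v) (x := x) (d := d) (E := E)) = 0
    · rw [hc]
      split_ifs with hEE
      · exact absurd (hEE ▸ hcoeffE) (by rw [hc]; exact Ne.symm hl)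
      · rfl
    · obtain ⟨b, hb, hbE⟩ := exists_tuple_of_coeff_deltaUpT_ne_zero hu hv hc
      have hq : coeff (∑ j, b j) (tailDiff u v) ≠ 0 := by
        rwa [← hbE, coeff_deltaUpT_tupleExpE hu hv halph hdis hb] at hc
      have hptb : pt x d E' = ιZ (∑ j, b j) := by
        rw [← hbE, pt_sum, ιZ_sum]
        exact Finset.sum_congr rfl fun j _ => pt_lamT hu hv halph (Fintype.mem_piFinset.mp hb j)
      have hwq : wt ξ (∑ j, b j) = lw κ E' := by rw [hκ, lw_κw, hptb, wtZ_ιZ]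
      have hql : ∑ j, b j = l := by
        by_contra hne
        have := htop.2 _ (Finset.mem_coe.mpr (mem_support_iff.mpr hq)) hne
        rw [hwq] at this
        exact absurd hE' (not_le.mpr this)
      have hEE : E' = Ex := by
        obtain ⟨s1, s2⟩ := realizable_tupleExpT halph b (u := u) (v := v) (x := x) (d := d)
        rw [← hbE]
        refine pt_injOn_realizable hdis s1 s2 hEm hEk ?_
        rw [hbE, hptb, hql, hptE]
      subst hEE
      rw [if_pos rfl, hcoeffE]
  obtain ⟨c, hc, htame⟩ := exists_tame_liftWT halph hED hval (u := u) (v := v) (x := x) (d := d)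
  have htU : ∀ j, Tame κ c (ellUT (u := u) (v := v) (x := x) (d := d) (E := E) j) := fun j => htame u j (huA j)
  have htV : ∀ j, Tame κ c (ellVT (u := u) (v := v) (x := x) (d := d) (E := E) j) := fun j => htame v j (hvA j)
  have hU0 : ∀ j, coeff 0 (ellUT (u := u) (v := v) (x := x) (d := d) (E := E) j) = 0 := by
    intro j
    rw [ellUT, liftW, coeff_sum]
    refine Finset.sum_eq_zero fun e he => ?_
    rw [coeff_monomial, if_neg]
    intro h0e
    obtain ⟨_, hyd, _⟩ := (isLetterExpT_lamT halph (huA j he)).pt_eq (x := x) (d := d)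
    rw [h0e] at hyd
    simp [ydeg] at hyd
  have hV0 : ∀ j, coeff 0 (ellVT (u := u) (v := v) (x := x) (d := d) (E := E) j) = 0 := by
    intro j
    rw [ellVT, liftW, coeff_sum]
    refine Finset.sum_eq_zero fun e he => ?_
    rw [coeff_monomial, if_neg]
    intro h0e
    obtain ⟨_, hyd, _⟩ := (isLetterExpT_lamT halph (hvA j he)).pt_eq (x := x) (d := d)
    rw [h0e] at hyd
    simp [ydeg] at hyd
  have hΛ : ∀ R : ℕ, -w₀ ≤ c * R → ∀ E' : Option (Fin n) →₀ ℕ, w₀ ≤ lw κ E' →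
      (if 1 ≤ ydeg E' ∧ ydeg E' ≤ R + 1 then ((-1 : ℂ) ^ (ydeg E' + 1) / (ydeg E' : ℂ)) *
        (Nat.multinomial Finset.univ (fun i => E' (some i)) : ℂ) * layerT γu γv (E' none) (fun i => E' (some i)) else 0) =
      coeff E' (monomial Ex G) := by
    intro R hR E' hE'
    have ht := topEq_logT_of_topEq_prod hc Finset.univ Finset.univ _ _ hU0 hV0 htU htV hlwE htopΔ hR E' hE'
    simp_rw [ellUT_eq_polyForm halph, ellVT_eq_polyForm halph] at ht
    rw [coeff_logSum_polyForm_sub] at ht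
    exact ht
  obtain ⟨R₀, hR₀⟩ : ∃ R₀ : ℕ, -w₀ ≤ c * R₀ := by
    refine ⟨⌈-w₀ / c⌉₊, ?_⟩
    have h1 : -w₀ / c ≤ (⌈-w₀ / c⌉₊ : ℝ) := Nat.le_ceil _
    calc -w₀ = c * (-w₀ / c) := by field_simp
      _ ≤ c * ⌈-w₀ / c⌉₊ := by gcongr
  have hRmono : ∀ R : ℕ, R₀ ≤ R → -w₀ ≤ c * R := fun R hR =>
    hR₀.trans (by gcongr)
  have hEm' : ydeg Ex ≤ m := hEm
  have hEk' : Ex none ∈ sumset E (ydeg Ex) := hEk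
  have hydE : 1 ≤ ydeg Ex := by
    by_contra hlt
    have hy0 : ydeg Ex = 0 := by omega
    have hE0 : Ex = 0 := by
      ext w
      cases w with
      | none =>
        have h1 : Ex none ∈ sumset E 0 := hy0 ▸ hEk'
        simpa [sumset] using h1
      | some i =>
        have h1 := Finset.single_le_sum (f := fun i => Ex (some i)) (fun i _ => Nat.zero_le _) (Finset.mem_univ i)
        rw [show ∑ i, Ex (some i) = ydeg Ex from rfl, hy0] at h1
        exact Nat.le_zero.mp h1
    have hl0 : l = 0 := by
      apply ιZ_injective
      rw [← hptE, hE0, pt_zero, ιZ_zero]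
    apply hl
    rw [hG, hl0, tailDiff, coeff_sub, coeff_zero_prod_one_add _ _ hu, coeff_zero_prod_one_add _ _ hv, sub_self]
  have hlive : layerT γu γv (Ex none) (fun i => Ex (some i)) ≠ 0 := by
    have h := hΛ (R₀ + m) (hRmono _ (Nat.le_add_right _ _)) Ex hlwE.ge
    rw [coeff_monomial, if_pos rfl, if_pos ⟨hydE, by omega⟩] at h
    intro h0
    rw [h0, mul_zero] at h
    exact hl h.symm
  refine ⟨Ex, hEm', hEk', hptE, hlive, fun E' hne hlive' => ?_⟩
  by_contra hge
  rw [not_lt] at hge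
  have hge' : w₀ ≤ lw κ E' := by rw [hκ, lw_κw]; exact hge
  have hyd' : 1 ≤ ydeg E' := by
    by_contra hlt
    exact hlive' (layerT_eq_zero_of_ydeg_eq_zero _ _ (by omega) _)
  have h := hΛ (R₀ + ydeg E') (hRmono _ (Nat.le_add_right _ _)) E' hge'
  rw [coeff_monomial, if_neg (Ne.symm hne), if_pos ⟨hyd', by omega⟩] at h
  exact (mul_ne_zero (classConst_ne_zero hyd') hlive') h

/-- The realizable record of a visible point, in the landed vocabulary (box `shallowPairsT n m D` for `E ⊆ [0, D]`). [folklore] -/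
theorem exists_isRecordT_of_isStrictTopE (hu : ∀ j, coeff 0 (u j) = 0) (hv : ∀ j, coeff 0 (v j) = 0)
    (halph : TowerAlphabet u v x d E) {D : ℕ} (hED : ∀ j ∈ E, j ≤ D) (hdis : TowerDissociatedE x d m E)
    {ξ : Fin 2 → ℝ} (hval : ValidWeight u v ξ) {l : Expo} (htop : IsStrictTop ξ (↑(tailDiff u v).support) l) :
    ∃ p : (Fin n → ℕ) × ℕ, p ∈ shallowPairsT n m D ∧ ptZ x d p.1 p.2 = ιZ l ∧
      IsRecordT (gammaOf u v x d E u) (gammaOf u v x d E v) x d m ξ p := by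
  obtain ⟨Ex, hEm, hEk, hptE, hlive, hrec⟩ := exists_liveTopT_of_isStrictTopE hu hv halph hED hdis hval htop
  refine ⟨(fun i => Ex (some i), Ex none), ?_, by rw [← pt_eq_ptZ, hptE], ?_, ?_⟩
  · rw [shallowPairsT, Finset.mem_product, Fintype.mem_piFinset]
    refine ⟨fun i => Finset.mem_range.mpr (Nat.lt_succ_of_le ?_), Finset.mem_range.mpr (Nat.lt_succ_of_le ?_)⟩
    · exact (Finset.single_le_sum (f := fun i => Ex (some i)) (fun i _ => Nat.zero_le _) (Finset.mem_univ i)).trans hEm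
    · exact (le_of_mem_sumset hED hEk).trans (Nat.mul_le_mul_left _ hEm)
  · exact ⟨hEm, hlive⟩
  · rintro ⟨S', k'⟩ ⟨_, hlive'⟩ hne
    set E' : Option (Fin n) →₀ ℕ := embS S' + Finsupp.single none k' with hE'
    have hS' : (fun i => E' (some i)) = S' := funext fun i => by rw [hE', embS_add_single_apply]; rfl
    have hk' : E' none = k' := by rw [hE', embS_add_single_apply]; rfl
    have hne' : E' ≠ Ex := by
      intro h
      apply hne
      rw [Prod.mk.injEq, ← hS', ← hk', h]
      exact ⟨rfl, rfl⟩
    have h := hrec E' hne' (by rw [hS', hk']; exact hlive')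
    rw [hE', pt_embS_add_single] at h
    simp only
    rw [← pt_eq_ptZ, hptE, wtZ_ιZ]
    exact h

/-- Reindexing to the occurring carriers keeps realizable dissociation. [folklore] -/
theorem exists_reindexE (halph : TowerAlphabet u v x d E) (hdis : TowerDissociatedE x d m E) :
    ∃ (n' : ℕ) (x' : Fin n' → Expo), n' ≤ (tailSupport u v).card ∧ TowerAlphabet u v x' d E ∧ TowerDissociatedE x' d m E := by
  classical
  set L := tailSupport u v with hL
  set car : L → Fin n := fun e => Classical.choose (halph e.1 e.2) with hcar
  have hcar_spec : ∀ e : L, ∃ j ∈ E, ∀ c, ((e.1 c : ℕ) : ℤ) = ((x (car e) c : ℕ) : ℤ) + (j : ℤ) * d c :=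
    fun e => Classical.choose_spec (halph e.1 e.2)
  set C : Finset (Fin n) := L.attach.image car with hC
  set x' : Fin C.card → Expo := fun i' => x (C.equivFin.symm i').1 with hx'
  refine ⟨C.card, x', ?_, ?_, ?_⟩
  · exact Finset.card_image_le.trans (by rw [Finset.card_attach])
  · intro e he
    have hmem : car ⟨e, he⟩ ∈ C := Finset.mem_image.mpr ⟨⟨e, he⟩, Finset.mem_attach _ _, rfl⟩
    refine ⟨C.equivFin ⟨car ⟨e, he⟩, hmem⟩, ?_⟩
    have hxe : x' (C.equivFin ⟨car ⟨e, he⟩, hmem⟩) = x (car ⟨e, he⟩) := by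
      rw [hx']; simp
    obtain ⟨j, hj, h⟩ := hcar_spec ⟨e, he⟩
    refine ⟨j, hj, fun c => ?_⟩
    rw [hxe]
    exact h c
  · intro S₁ S₂ k₁ k₂ h1 h2 hk1 hk2 hpt
    have key := hdis (extC C S₁) (extC C S₂) k₁ k₂ (by rw [size_extC]; exact h1) (by rw [size_extC]; exact h2)
      (by rw [size_extC]; exact hk1) (by rw [size_extC]; exact hk2) (by rw [ptZ_extC, ptZ_extC]; exact hpt)
    refine ⟨funext fun i' => ?_, key.2⟩
    rw [← extC_apply_symm C S₁ i', ← extC_apply_symm C S₂ i', key.1]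

/-- **A cell family injects into the records of the tower data, under REALIZABLE dissociation.** [folklore] -/
theorem card_cellFamily_le_recordsE {t : ℕ} {D : ℕ}
    (hu : ∀ j, coeff 0 (u j) = 0 ∧ (u j).support.card ≤ t) (hv : ∀ j, coeff 0 (v j) = 0 ∧ (v j).support.card ≤ t)
    (halph : TowerAlphabet u v x d E) (hED : ∀ j ∈ E, j ≤ D) (hdis : TowerDissociatedE x d m E)
    (R : Expo → Expo → Prop) (S : Finset Expo) (hS : IsCellFamily u v R S) :
    ∃ (n' : ℕ) (x' : Fin n' → Expo), n' ≤ 2 * m * t ∧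
      DegLe (gammaOf u v x' d E u) D ∧ DegLe (gammaOf u v x' d E v) D ∧
      S.card ≤ ((shallowPairsT n' m D).filter fun p => ∃ ξ : Fin 2 → ℝ,
        IsRecordT (gammaOf u v x' d E u) (gammaOf u v x' d E v) x' d m ξ p).card := by
  classical
  have hu0 : ∀ j, coeff 0 (u j) = 0 := fun j => (hu j).1
  have hv0 : ∀ j, coeff 0 (v j) = 0 := fun j => (hv j).1
  obtain ⟨n', x', hn', halph', hdis'⟩ := exists_reindexE halph hdis
  have hn'le : n' ≤ 2 * m * t :=
    hn'.trans (Summit.ValiantsHypothesis.ValiantsHypothesis.Theorems.NewtonUnitEquations.TwoProducts.Submerged.card_tailSupport_le u v t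
      (fun j => (hu j).2) fun j => (hv j).2)
  refine ⟨n', x', hn'le, degLe_gammaOf hED u, degLe_gammaOf hED v, ?_⟩
  set γu := gammaOf u v x' d E u
  set γv := gammaOf u v x' d E v
  set Rec := (shallowPairsT n' m D).filter fun p => ∃ ξ : Fin 2 → ℝ, IsRecordT γu γv x' d m ξ p with hRec
  have hrec : ∀ l ∈ S, ∃ p ∈ Rec, ptZ x' d p.1 p.2 = ιZ l := by
    intro l hl
    obtain ⟨ξ, hval, htop, -⟩ := hS l hl
    have htop' : IsStrictTop ξ (↑(tailDiff u v).support) l := (stub_logLinearisation m u v hu0 hv0 ξ hval l).2 htop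
    obtain ⟨p, hp, hpt, hrecp⟩ := exists_isRecordT_of_isStrictTopE hu0 hv0 halph' hED hdis' hval htop'
    exact ⟨p, Finset.mem_filter.mpr ⟨hp, ξ, hrecp⟩, hpt⟩
  choose! rep hrep hptrep using hrec
  exact Finset.card_le_card_of_injOn rep (fun l hl => hrep l hl) (fun l₁ h₁ l₂ h₂ h => by
    apply ιZ_injective
    rw [← hptrep l₁ (Finset.mem_coe.mp h₁), ← hptrep l₂ (Finset.mem_coe.mp h₂), h])

end Realizable

end Lift

end Summit.ValiantsHypothesis.ValiantsHypothesis.Theorems.NewtonUnitEquations.TwoProducts.TowerRecord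

end
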